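import Summits.ResolutionOfSingularities.ResolutionOfSingularities.Theorems.PurelyInseparableDim4PhiLineVertexPerturbation
import Literature.AlgebraicGeometry.Resolution.StandardBasisSolvabilityIndexed
import HarnessLib

/-!
# (K-Φ3) label propagation II: frame moves — the twist `u₂ ↦ u₂ + λ u₁` (CJS Lemma 13.6, indexed) leaves `α`, `β`, `δ`
# unchanged; a dissolution `y ↦ y + λ u₁^a u₂^b` strictly right of the column of `v` leaves `α`, `β` unchanged and does not lower `δ`

Cell `res-dim4-pi` (D-0157 DOOR 2), Φ = β_h line (res-dim4-idea-1, CARD I-1-6/7/8), kernel target (K-Φ3) of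
`pub/res-dim4/res-dim4-idea-1/lean-g5/Sketch.lean` (ade7af20c994a8b6), typing target (L3) of memo `B-infinity-critical-frame.md` §6.6
(«r-indexed `betaS_shiftU₂`»): at a LOSE-h step the step frame of `PhiLine.keepCount_add_betaS_le` is the arrival frame TWISTED by
`ũ₂ = u₂ − φ u₁`; this file discharges the binders `hgens`, `hne`, `hδ`, `hsa` (the last with EQUALITY) for that move, for every `r`, as
an instance of `PhiLine.alphaS_betaS_eq_of_forall_sub_mem` (previous file) — the tree's `Fin 3` file `PolygonShear.lean`
(`alphaS_shiftU₂`, `betaS_shiftU₂`, `deltaS_shiftU₂`) ported to `WeightedOrder.u2Shear`: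

* `apply_sub_u2Shear_mem`, **`isInitialTerm_u2Shear`** (initial unit terms for a strictly steep weight `w_{u₂} < w_{u₁}` survive the
  shear), `span_range_u2Shear_eq` (`hgens`);
* `forall_pts_u2Shear_of_forall_pts` (half-planes with `p₁ ≥ p₂ > 0` transfer), `pts_u2Shear_nonempty_and_alphaS_betaS_eq`,
  `pts_u2Shear_nonempty` (`hne`), **`alphaS_u2Shear`**, **`betaS_u2Shear`** (`hsa`, `=`), **`deltaS_u2Shear`**,
  `factorial_lt_deltaS_u2Shear_iff` (`hδ`), `twist_binders` (the three binders packaged in the Sketch's shape);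
* the DISSOLUTION `yShift c (λ u₁^a u₂^b)` (CJS Thm. 8.16; memo §6.2 (P4)(i) «column safety» / (C5), and the single `(2,0)`-move of
  idea-1 g6's I-1-8 plan): `apply_sub_yShift_uMonom_mem`, `span_range_yShift_uMonom_eq` (`hgens`),
  **`pts_yShift_uMonom_nonempty_and_alphaS_betaS_eq`** / `alphaS_yShift_uMonom` / `betaS_yShift_uMonom` (a lattice point with
  `a·μ! > αs` dissolves without moving `v`; `hsa` with `=`), `deltaS_le_deltaS_yShift_uMonom` (`(a+b)·μ! ≥ δs ⇒ δs ≤ δs′`),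
  `dissolve_binders`.

[OURS · counted 0 · AI work weaker than expert review.] Nothing here proves K2(p), `NoAboveFloorTrap`, the β_h line, or resolution of
singularities in dimension ≥ 4 / characteristic p.

Sources: V. Cossart, U. Jannsen, S. Saito, LNM **2270** (2020), Lemma 13.6, Lemma 12.6, Thm. 8.16, Lemma 11.4 [`CossartJannsenSaito2020`];
V. Cossart, O. Piltant, J. Algebra 320 (2008), proof of Lemma 4.5 (2), pp. 11–12 [`CossartPiltant2008`]. Tree: `Literature/AlgebraicGeometry/
Resolution/PolygonShear.lean`, `StandardBasisSolvabilityIndexed.lean` (`forall_pts_yShift_of_forall_pts`, the half-plane form).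
-/

noncomputable section

open IsLocalRing MvPolynomial
open Literature.AlgebraicGeometry.Resolution (weightedOrderIdeal weightedOrderIdeal_antitone apply_mem_weightedOrderIdeal)
open Literature.AlgebraicGeometry.Resolution.WeightedOrder

set_option linter.dupNamespace false

namespace Summit.ResolutionOfSingularities.ResolutionOfSingularities.Theorems.PIDim4.PhiLine

universe u

/-! ## The shear `u₂ ↦ u₂ + λ u₁` for a strictly steep weight -/

section ShearGeneric

variable {R : Type u} [CommRing R] {r : ℕ} (c : Fin (r + 2) → R) (lam : R)

/-- For `w_{u₂} < w_{u₁}`: `c_i − (u2Shear c λ)_i ∈ F_{w_i + 1}(c)` for every `i` (the only non-zero difference is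
`−λ u₁ ∈ F_{w_{u₁}} ⊆ F_{w_{u₂}+1}`). [cite: CossartJannsenSaito2020, Lemma 13.6] -/
theorem apply_sub_u2Shear_mem {w : Fin (r + 2) → ℕ} (hw : w (u2 r) < w (u1 r)) (i : Fin (r + 2)) :
    c i - u2Shear c lam i ∈ weightedOrderIdeal c w (w i + 1) := by
  by_cases hi : i = u2 r
  · subst hi
    rw [u2Shear_u2]
    have hsplit : c (u2 r) - (c (u2 r) + lam * c (u1 r)) = -(lam * c (u1 r)) := by ring
    rw [hsplit]
    exact Submodule.neg_mem _ (Ideal.mul_mem_left _ _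
      (weightedOrderIdeal_antitone c w (Nat.succ_le_of_lt hw) (apply_mem_weightedOrderIdeal c w (u1 r))))
  · rw [u2Shear_of_ne c lam hi, sub_self]; exact Ideal.zero_mem _

/-- **Initial unit terms for a strictly steep weight (`w_{u₂} < w_{u₁}`) survive the shear** `u₂ ↦ u₂ + λ u₁`
(indexed form of `PolygonShear`'s `IsInitialTerm.shear`). [cite: CossartJannsenSaito2020, Lemma 13.6] -/
theorem isInitialTerm_u2Shear {w : Fin (r + 2) → ℕ} (hw : w (u2 r) < w (u1 r)) {f : R} {e : Fin (r + 2) →₀ ℕ}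
    (he : IsInitialTerm c w f e) : IsInitialTerm (u2Shear c lam) w f e :=
  isInitialTerm_of_forall_sub_mem c (u2Shear c lam) w (apply_sub_u2Shear_mem c lam hw)
    (fun ρ => weightedOrderIdeal_u2Shear c lam w hw.le ρ) he

/-- The sheared system generates the same ideal (the `hgens` binder of the Sketch from `hgena`).
[cite: CossartJannsenSaito2020, Lemma 13.6] -/
theorem span_range_u2Shear_eq [IsLocalRing R] (hgen : Ideal.span (Set.range c) = maximalIdeal R) :
    Ideal.span (Set.range (u2Shear c lam)) = maximalIdeal R := by
  rw [span_range_u2Shear]; exact hgen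

end ShearGeneric

/-! ## CJS Lemma 13.6 for the indexed polygon: `α`, `β`, `δ` are shear invariant -/

section Shear

variable {R : Type u} [CommRing R] [IsRegularLocalRing R] {r : ℕ} (c : Fin (r + 2) → R)
  (hgen : Ideal.span (Set.range c) = maximalIdeal R) (hdim : ringKrullDim R = r + 2) (lam : R)
  {J : Ideal R} {μ : ℕ}

include hgen hdim in
/-- **Half-planes `p₁ x₁ + p₂ x₂ ≥ w₀` with `p₁ ≥ p₂ > 0` transfer to the sheared system** `(y, u₁, u₂ + λu₁)` — the half-plane is the
membership `J ⊆ F^{(w₀,…,w₀, Lp₁, Lp₂)}_{w₀ μ}` and that weighted order ideal is shear invariant since `L p₂ ≤ L p₁`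
(`weightedOrderIdeal_u2Shear`). [cite: CossartJannsenSaito2020, Lemma 13.6] -/
theorem forall_pts_u2Shear_of_forall_pts {w₀ p₁ p₂ : ℕ} (hw₀ : 0 < w₀) (hp₂ : 0 < p₂) (hp : p₂ ≤ p₁)
    (hS : ∀ e ∈ pts c J μ, w₀ ≤ p₁ * spt₁ μ e + p₂ * spt₂ μ e) :
    ∀ e ∈ pts (u2Shear c lam) J μ, w₀ ≤ p₁ * spt₁ μ e + p₂ * spt₂ μ e := by
  have hp₁ : 0 < p₁ := lt_of_lt_of_le hp₂ hp
  have h1 := (le_weightedOrderIdeal_levelWeight_iff c hgen hdim J hw₀ hp₁ hp₂).mpr hS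
  have hW : levelWeight (r := r) μ w₀ p₁ p₂ (u2 r) ≤ levelWeight (r := r) μ w₀ p₁ p₂ (u1 r) := by
    rw [levelWeight_u1, levelWeight_u2]; exact Nat.mul_le_mul_left _ hp
  rw [← weightedOrderIdeal_u2Shear c lam (levelWeight μ w₀ p₁ p₂) hW] at h1
  exact (le_weightedOrderIdeal_levelWeight_iff (u2Shear c lam) (span_range_u2Shear_eq c lam hgen) hdim J hw₀ hp₁ hp₂).mp h1

include hgen hdim in
/-- **CJS Lemma 13.6, indexed: the vertex `𝐯 = (α, β)` is shear invariant** — the polygon of `(y, u₁, u₂ + λu₁)` is non-empty and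
its `αs`, `βs` equal those of `(y, u₁, u₂)` (`J ⊆ 𝔪^μ`, non-empty polygon): instance of `alphaS_betaS_eq_of_forall_sub_mem` with
threshold `N₀ = βs + 2` (steep weights `(…, L N, L)` have `w_{u₂} ≤ w_{u₁}`, strictly for `N ≥ 2`).
[cite: CossartJannsenSaito2020, Lemma 13.6] [cite: CossartPiltant2008, proof of Lemma 4.5 (2), p. 12] -/
theorem pts_u2Shear_nonempty_and_alphaS_betaS_eq (hJμ : J ≤ maximalIdeal R ^ μ) (hne : (pts c J μ).Nonempty) :
    (pts (u2Shear c lam) J μ).Nonempty ∧ alphaS (u2Shear c lam) J μ = alphaS c J μ ∧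
      betaS (u2Shear c lam) J μ = betaS c J μ := by
  have hL := Nat.factorial_pos μ
  refine alphaS_betaS_eq_of_forall_sub_mem c (u2Shear c lam) hgen hdim (span_range_u2Shear_eq c lam hgen) hJμ hne
    (N₀ := betaS c J μ + 2) (by omega) (fun N hN ρ => weightedOrderIdeal_u2Shear c lam _ ?_ ρ) ?_
  · rw [levelWeight_u1, levelWeight_u2]; exact Nat.mul_le_mul_left _ (by omega)
  · refine apply_sub_u2Shear_mem c lam ?_
    rw [levelWeight_u1, levelWeight_u2]; exact Nat.mul_lt_mul_of_pos_left (by omega) hL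

include hgen hdim in
/-- The polygon of the sheared system is non-empty when that of `c` is (`J ⊆ 𝔪^μ`) — the `hne` binder of the Sketch for a twisted
step frame. [cite: CossartJannsenSaito2020, Lemma 13.6] -/
theorem pts_u2Shear_nonempty (hJμ : J ≤ maximalIdeal R ^ μ) (hne : (pts c J μ).Nonempty) :
    (pts (u2Shear c lam) J μ).Nonempty :=
  (pts_u2Shear_nonempty_and_alphaS_betaS_eq c hgen hdim lam hJμ hne).1

include hgen hdim in
/-- `α` is shear invariant (indexed). [cite: CossartJannsenSaito2020, Lemma 13.6] -/
theorem alphaS_u2Shear (hJμ : J ≤ maximalIdeal R ^ μ) (hne : (pts c J μ).Nonempty) :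
    alphaS (u2Shear c lam) J μ = alphaS c J μ :=
  (pts_u2Shear_nonempty_and_alphaS_betaS_eq c hgen hdim lam hJμ hne).2.1

include hgen hdim in
/-- `β` is shear invariant (indexed) — the `hsa` binder of the Sketch for a twisted step frame, with EQUALITY.
[cite: CossartJannsenSaito2020, Lemma 13.6] -/
theorem betaS_u2Shear (hJμ : J ≤ maximalIdeal R ^ μ) (hne : (pts c J μ).Nonempty) :
    betaS (u2Shear c lam) J μ = betaS c J μ :=
  (pts_u2Shear_nonempty_and_alphaS_betaS_eq c hgen hdim lam hJμ hne).2.2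

include hgen hdim in
/-- `δ` is shear invariant (indexed; the `δ`-line `x₁ + x₂` has equal weights `W_{u₁} = W_{u₂}`, for which the weighted order ideals
are still shear invariant; one inequality for an arbitrary shear, then shear back). [cite: CossartJannsenSaito2020, Lemma 13.6] -/
theorem deltaS_u2Shear (hJμ : J ≤ maximalIdeal R ^ μ) (hne : (pts c J μ).Nonempty) :
    deltaS (u2Shear c lam) J μ = deltaS c J μ := by
  have key : ∀ (c₁ : Fin (r + 2) → R), Ideal.span (Set.range c₁) = maximalIdeal R →
      (pts c₁ J μ).Nonempty → ∀ ψ : R, deltaS c₁ J μ ≤ deltaS (u2Shear c₁ ψ) J μ := by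
    intro c₁ hgen₁ hne₁ ψ
    have hne₁' := pts_u2Shear_nonempty c₁ hgen₁ hdim ψ hJμ hne₁
    obtain ⟨e, he, hsum⟩ := exists_pts_deltaS hne₁'
    have hδpos : 0 < deltaS c₁ J μ := by
      obtain ⟨e₀, he₀, h₀⟩ := exists_pts_deltaS hne₁
      have := factorial_le_spt_add c₁ hgen₁ hdim hJμ he₀
      have := Nat.factorial_pos μ
      omega
    have h := forall_pts_u2Shear_of_forall_pts c₁ hgen₁ hdim ψ hδpos Nat.one_pos le_rfl
      (fun x hx => by simpa using deltaS_le hx) e he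
    rw [← hsum]; simpa using h
  refine le_antisymm ?_ (key c hgen hne lam)
  have h := key (u2Shear c lam) (span_range_u2Shear_eq c lam hgen) (pts_u2Shear_nonempty c hgen hdim lam hJμ hne) (-lam)
  rwa [u2Shear_u2Shear_neg] at h

include hgen hdim in
/-- `δ > 1` transfers to the sheared system (the `hδ` binder of the Sketch for a twisted step frame).
[cite: CossartJannsenSaito2020, Lemma 13.6] -/
theorem factorial_lt_deltaS_u2Shear_iff (hJμ : J ≤ maximalIdeal R ^ μ) (hne : (pts c J μ).Nonempty) :
    μ.factorial < deltaS (u2Shear c lam) J μ ↔ μ.factorial < deltaS c J μ := by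
  rw [deltaS_u2Shear c hgen hdim lam hJμ hne]

include hgen hdim in
/-- **(K-Φ3), twist part, in the Sketch's binder shape.** If the step frame is the arrival frame twisted by `u₂ ↦ u₂ + λ u₁`, then
the binders `hne`, `hδ`, `hsa` of `PhiLine.keepCount_add_betaS_le` for the step frame follow from the same facts for the arrival
frame — with `hsa` an equality (`betaS_u2Shear`); `hgens` is `span_range_u2Shear_eq`. [cite: CossartJannsenSaito2020, Lemma 13.6] -/
theorem twist_binders (hJμ : J ≤ maximalIdeal R ^ μ) (hne : (pts c J μ).Nonempty) (hδ : μ.factorial < deltaS c J μ) :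
    (pts (u2Shear c lam) J μ).Nonempty ∧ μ.factorial < deltaS (u2Shear c lam) J μ ∧
      betaS (u2Shear c lam) J μ ≤ betaS c J μ :=
  ⟨pts_u2Shear_nonempty c hgen hdim lam hJμ hne, (factorial_lt_deltaS_u2Shear_iff c hgen hdim lam hJμ hne).mpr hδ,
    (betaS_u2Shear c hgen hdim lam hJμ hne).le⟩

end Shear

/-! ## The dissolution `y_j ↦ y_j + λ_j u₁^a u₂^b` of a lattice point strictly right of the column of `v` -/

section Dissolution

variable {R : Type u} [CommRing R] {r : ℕ} (c : Fin (r + 2) → R) (lam : Fin r → R) (a b : ℕ)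

/-- If the lattice point `(a, b)` lies STRICTLY above the line of the weight `w` seen from every `y_j` (`w_{y_j} + 1 ≤ a w_{u₁} + b w_{u₂}`),
then `c_i − (yShift c (λ u₁^a u₂^b))_i ∈ F_{w_i + 1}(c)` for every `i` (the only non-zero differences are `−λ_j u₁^a u₂^b`).
[cite: CossartJannsenSaito2020, Thm. 8.16] -/
theorem apply_sub_yShift_uMonom_mem {w : Fin (r + 2) → ℕ} (h : ∀ j : Fin r, w (Fin.castAdd 2 j) + 1 ≤ a * w (u1 r) + b * w (u2 r))
    (i : Fin (r + 2)) :
    c i - yShift c (fun j => uMonom c (lam j) a b) i ∈ weightedOrderIdeal c w (w i + 1) := by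
  refine Fin.addCases (fun j => ?_) (fun j => ?_) i
  · rw [yShift_y]
    have hsplit : c (Fin.castAdd 2 j) - (c (Fin.castAdd 2 j) + uMonom c (lam j) a b) = -uMonom c (lam j) a b := by ring
    rw [hsplit]
    exact Submodule.neg_mem _ (uMonom_mem_weightedOrderIdeal c w (lam j) (h j))
  · fin_cases j
    · change c (u1 r) - yShift c _ (u1 r) ∈ _
      rw [yShift_u1, sub_self]; exact Ideal.zero_mem _
    · change c (u2 r) - yShift c _ (u2 r) ∈ _
      rw [yShift_u2, sub_self]; exact Ideal.zero_mem _

/-- The dissolved system generates the maximal ideal when `(a, b) ≠ 0` (the `hgens` binder of the Sketch for a re-adapted step frame).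
[cite: CossartJannsenSaito2020, Def. 8.2 (3)] -/
theorem span_range_yShift_uMonom_eq [IsLocalRing R] (hab : 0 < a + b) (hgen : Ideal.span (Set.range c) = maximalIdeal R) :
    Ideal.span (Set.range (yShift c fun j => uMonom c (lam j) a b)) = maximalIdeal R := by
  rw [span_range_yShift c _ fun j => uMonom_mem_span_pair c hab _, hgen]

variable [IsRegularLocalRing R] (hgen : Ideal.span (Set.range c) = maximalIdeal R) (hdim : ringKrullDim R = r + 2)
  {J : Ideal R} {μ : ℕ}

include hgen hdim in
/-- **Column safety (memo §6.2 (P4)(i), (C5)), indexed and expansion-free: dissolving a lattice point STRICTLY RIGHT of the column of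
`v` leaves the vertex unchanged.** If `a·μ! > αs` (the point `(a, b)` lies strictly right of the line `x₁ = α`) and `(a, b) ≠ 0`, then
for every `λ : Fin r → R` the polygon of `(J, μ)` in the frame `(y + λ u₁^a u₂^b, u₁, u₂)` is non-empty with the same `αs`, `βs`
(`J ⊆ 𝔪^μ`, non-empty polygon): instance of `alphaS_betaS_eq_of_forall_sub_mem` with threshold `N₀ = βs + 1` — every steep line
`N x₁ + x₂ = N α + β`, `N > β`, passes strictly below `(a, b)`. In I-1-8 (idea-1 g6): the single `(2,0)`-dissolution of a CARRIED label
with `α < 1`. [cite: CossartJannsenSaito2020, Thm. 8.16] [cite: CossartPiltant2008, §4 p. 11] -/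
theorem pts_yShift_uMonom_nonempty_and_alphaS_betaS_eq (hJμ : J ≤ maximalIdeal R ^ μ) (hne : (pts c J μ).Nonempty)
    (hab : 0 < a + b) (hα : alphaS c J μ < a * μ.factorial) :
    (pts (yShift c fun j => uMonom c (lam j) a b) J μ).Nonempty ∧
      alphaS (yShift c fun j => uMonom c (lam j) a b) J μ = alphaS c J μ ∧
        betaS (yShift c fun j => uMonom c (lam j) a b) J μ = betaS c J μ := by
  -- the steep level weight of slope `N > βs` sees `(a, b)` strictly above its line
  have key : ∀ N, betaS c J μ < N → ∀ j : Fin r,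
      levelWeight (r := r) μ (N * alphaS c J μ + betaS c J μ) N 1 (Fin.castAdd 2 j) + 1 ≤
        a * levelWeight (r := r) μ (N * alphaS c J μ + betaS c J μ) N 1 (u1 r) +
          b * levelWeight (r := r) μ (N * alphaS c J μ + betaS c J μ) N 1 (u2 r) := by
    intro N hN j
    rw [levelWeight_y, levelWeight_u1, levelWeight_u2]
    have h1 : N * (alphaS c J μ + 1) ≤ N * (a * μ.factorial) := Nat.mul_le_mul_left N hα
    nlinarith [h1, hN, Nat.zero_le (b * (μ.factorial * 1))]
  refine alphaS_betaS_eq_of_forall_sub_mem c _ hgen hdim (span_range_yShift_uMonom_eq c lam a b hab hgen) hJμ hne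
    (N₀ := betaS c J μ + 1) (by omega) (fun N hN ρ => weightedOrderIdeal_yShift_uMonom c lam _ (fun j => ?_) ρ)
    (apply_sub_yShift_uMonom_mem c lam a b (key _ (by omega)))
  have := key N (by omega) j
  omega

include hgen hdim in
/-- `α` is unchanged by a dissolution strictly right of the column. [cite: CossartJannsenSaito2020, Thm. 8.16] -/
theorem alphaS_yShift_uMonom (hJμ : J ≤ maximalIdeal R ^ μ) (hne : (pts c J μ).Nonempty) (hab : 0 < a + b)
    (hα : alphaS c J μ < a * μ.factorial) : alphaS (yShift c fun j => uMonom c (lam j) a b) J μ = alphaS c J μ :=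
  (pts_yShift_uMonom_nonempty_and_alphaS_betaS_eq c lam a b hgen hdim hJμ hne hab hα).2.1

include hgen hdim in
/-- `β` is unchanged by a dissolution strictly right of the column — the `hsa` binder of the Sketch for a re-adapted step frame, with
EQUALITY. [cite: CossartJannsenSaito2020, Thm. 8.16] -/
theorem betaS_yShift_uMonom (hJμ : J ≤ maximalIdeal R ^ μ) (hne : (pts c J μ).Nonempty) (hab : 0 < a + b)
    (hα : alphaS c J μ < a * μ.factorial) : betaS (yShift c fun j => uMonom c (lam j) a b) J μ = betaS c J μ :=
  (pts_yShift_uMonom_nonempty_and_alphaS_betaS_eq c lam a b hgen hdim hJμ hne hab hα).2.2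

include hgen hdim in
/-- **`δ` does not drop under a dissolution of a point on or above the `δ`-line** (`(a + b)·μ! ≥ δs`; CJS Thm. 8.16 (1) direction,
Lemma 11.4 (2) «preparation at vertices does not decrease δ»): if the dissolved polygon is non-empty, `δs ≤ δs′`.
[cite: CossartJannsenSaito2020, Thm. 8.16] [cite: CossartJannsenSaito2020, Lemma 11.4] -/
theorem deltaS_le_deltaS_yShift_uMonom (hJμ : J ≤ maximalIdeal R ^ μ) (hne : (pts c J μ).Nonempty)
    (hv : deltaS c J μ ≤ (a + b) * μ.factorial) (hne' : (pts (yShift c fun j => uMonom c (lam j) a b) J μ).Nonempty) :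
    deltaS c J μ ≤ deltaS (yShift c fun j => uMonom c (lam j) a b) J μ := by
  have hδpos : 0 < deltaS c J μ := by
    obtain ⟨e₀, he₀, h₀⟩ := exists_pts_deltaS hne
    have := factorial_le_spt_add c hgen hdim hJμ he₀
    have := Nat.factorial_pos μ
    omega
  have hab : 0 < a + b := by
    rcases Nat.eq_zero_or_pos (a + b) with h0 | h0
    · rw [h0, zero_mul] at hv; omega
    · exact h0
  have h1 := (le_weightedOrderIdeal_levelWeight_iff c hgen hdim J hδpos Nat.one_pos Nat.one_pos).mpr
    (fun e he => by simpa using deltaS_le he)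
  have hW : ∀ j : Fin r, levelWeight (r := r) μ (deltaS c J μ) 1 1 (Fin.castAdd 2 j) ≤
      a * levelWeight (r := r) μ (deltaS c J μ) 1 1 (u1 r) + b * levelWeight (r := r) μ (deltaS c J μ) 1 1 (u2 r) := by
    intro j
    rw [levelWeight_y, levelWeight_u1, levelWeight_u2]
    nlinarith [hv]
  rw [← weightedOrderIdeal_yShift_uMonom c lam _ hW] at h1
  have h2 := (le_weightedOrderIdeal_levelWeight_iff _ (span_range_yShift_uMonom_eq c lam a b hab hgen) hdim J hδpos
    Nat.one_pos Nat.one_pos).mp h1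
  obtain ⟨e, he, hsum⟩ := exists_pts_deltaS hne'
  have := h2 e he
  rw [← hsum]; omega

include hgen hdim in
/-- **(K-Φ3), re-adaptation part, in the Sketch's binder shape.** For a step frame obtained from the arrival frame by dissolving a
lattice point `(a, b)` strictly right of the column of `v` (`a·μ! > αs`) and on or above the `δ`-line (`(a+b)·μ! ≥ δs`) — in I-1-8
the `(2,0)`-dissolution, `α < 1 < δ ≤ 2` — the binders `hne`, `hδ`, `hsa` of `PhiLine.keepCount_add_betaS_le` follow from the same
facts for the arrival frame, with `hsa` an equality (`betaS_yShift_uMonom`); `hgens` is `span_range_yShift_uMonom_eq`.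
[cite: CossartJannsenSaito2020, Thm. 8.16] -/
theorem dissolve_binders (hJμ : J ≤ maximalIdeal R ^ μ) (hne : (pts c J μ).Nonempty) (hδ : μ.factorial < deltaS c J μ)
    (hα : alphaS c J μ < a * μ.factorial) (hv : deltaS c J μ ≤ (a + b) * μ.factorial) :
    (pts (yShift c fun j => uMonom c (lam j) a b) J μ).Nonempty ∧
      μ.factorial < deltaS (yShift c fun j => uMonom c (lam j) a b) J μ ∧
        betaS (yShift c fun j => uMonom c (lam j) a b) J μ ≤ betaS c J μ := by
  have hab : 0 < a + b := by
    rcases Nat.eq_zero_or_pos (a + b) with h0 | h0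
    · rw [h0, zero_mul] at hv; have := Nat.factorial_pos μ; omega
    · exact h0
  obtain ⟨hne', -, hβ⟩ := pts_yShift_uMonom_nonempty_and_alphaS_betaS_eq c lam a b hgen hdim hJμ hne hab hα
  exact ⟨hne', lt_of_lt_of_le hδ (deltaS_le_deltaS_yShift_uMonom c lam a b hgen hdim hJμ hne hv hne'), hβ.le⟩

end Dissolution

end Summit.ResolutionOfSingularities.ResolutionOfSingularities.Theorems.PIDim4.PhiLine

end
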